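import Summits.QuantumAdvantage.QuantumAdvantage.Theorems.WbwObfuscatedGluedTreesKowBestPossibleStep
import Summits.QuantumAdvantage.QuantumAdvantage.Theorems.WbwObfuscatedGluedTreesKowLevelVocabulary

/-!
# `WbwObfuscatedGluedTrees` (stmt-QuantumAdvantage-2340) — line `knowledge-of-walk-split`, instantiation pass: stub `level_bestPossibleStep`

The registered stub `level_bestPossibleStep` of the instantiation pass of the line `knowledge-of-walk-split`
(crux `WbwObfuscatedGluedTrees`, route `WhiteBoxWalk`): the LEVEL-AWARE re-issue of `stub_bestPossibleStep`
(`WbwObfuscatedGluedTreesKowBestPossibleStep`).  For level-aware key-indexed families `C₀ n k ≡ C₁ n k`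
(same arity `m n k`, size and function, both in `ppolyCircuits (κ n)` for keys `k ∈ {0,1}^{h n}`), a
schedule `n^c ≤ κ n ≤ poly(n)`, `h n ≤ n`, polynomially bounded codes / names / answers, the eventual coin
discipline and a sub-exponentially secure iO `O` for `P/poly`,
`ClauseC (genObfL O κ h m C₁ nm) (keyedL h ans) → ClauseC (genObfL O κ h m C₀ nm) (keyedL h ans)`
(vocabulary of `WbwObfuscatedGluedTreesKowLevelVocabulary`, `ClauseC` of `Negative/LoadBearing`).

Proof: the level-oblivious proof, level by level (FREEZING: at level `n` the level-aware data is the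
level-oblivious family `(m n, C₀ n, C₁ n, nm n, ans n)`, so the instances are
`BestPossibleStep.xInst O κ (m n) (C n) (nm n) n k r` and the per-key gap is the advised iO advantage of
`BestPossibleStep.dist` by `BestPossibleStep.gap_eq_ioAdvantageAdv`).  Re-done level-aware (theorems only,
no new definitions): the seed law of the success sequence (`SeedLaw.uniformAvg_eq_key_coins`), the keyed iO
step with `(n, k)`-indexed families (`Negative.KeyedIndistinguishability.keyed_family_subexp` on the finite
key sets `BestPossibleStep.keys`), the polynomial instance-length bound, and the assembly (coin normalisation
`CoinNormalisation.norm`, averaging `SeedLaw.abs_uniformAvg_sub_le`, `SuperpolynomialDecay` algebra).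
-/

set_option linter.dupNamespace false

noncomputable section

namespace Summit.QuantumAdvantage.QuantumAdvantage.Theorems.WbwObfuscatedGluedTrees.KnowledgeOfWalk

open Literature.Computability.Cryptography Literature.Computability.Complexity
open _root_.Computability Polynomial Filter Asymptotics
open Summit.QuantumAdvantage.QuantumAdvantage.Theorems.WbwObfuscatedGluedTrees.Negative (ClauseC)

namespace LevelBps

open BestPossibleStep Summit.QuantumAdvantage.QuantumAdvantage.Theorems.WbwObfuscatedGluedTrees.Negative

/-! ### The success sequence of an adversary against `genObfL`: nonnegativity and seed law -/

/-- The success probability of `A` against `genObfL O κ h m C nm` / `keyedL h ans` at level `n` (the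
quantity clause (C) asks to decay) is nonnegative. [folklore] -/
theorem avgL_nonneg (O : CircuitObfuscator) (κ h : ℕ → ℕ) (m : ℕ → List Bool → ℕ)
    (C : (n : ℕ) → (k : List Bool) → Circuit (Fin (m n k))) (nm ans : ℕ → List Bool → List Bool)
    (A : RandAlg (List Bool) (List Bool)) (n : ℕ) :
    0 ≤ uniformAvg n fun s =>
      A.pr id (boolPair (unaryEncodeNat n) (genObfL O κ h m C nm s)) {y | keyedL h ans s <+: y} :=
  uniformAvg_nonneg fun _ => RandAlg.pr_nonneg _ _ _ _

/-- **Seed law for the success probability against `genObfL`**: a uniform key and uniform obfuscator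
coins; at level `n` the instance is `xInst` of the family frozen at level `n`. [folklore] -/
theorem avgL_eq_key_coins (O : CircuitObfuscator) (κ h : ℕ → ℕ) (m : ℕ → List Bool → ℕ)
    (C : (n : ℕ) → (k : List Bool) → Circuit (Fin (m n k))) (nm ans : ℕ → List Bool → List Bool)
    (A : RandAlg (List Bool) (List Bool)) (hh : ∀ n, h n ≤ n) (n : ℕ)
    (hcoins : ∀ k : List Bool, k.length = h n → O.coins (κ n) (C n k) ≤ n - h n) :
    (uniformAvg n fun s =>
        A.pr id (boolPair (unaryEncodeNat n) (genObfL O κ h m C nm s)) {y | keyedL h ans s <+: y}) =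
      uniformAvg (h n) fun k => uniformAvg (O.coins (κ n) (C n k)) fun r =>
        A.pr id (xInst O κ (m n) (C n) (nm n) n k r) {y | ans n k <+: y} := by
  refine SeedLaw.uniformAvg_eq_key_coins (hh n) (fun k => O.coins (κ n) (C n k)) hcoins _ _ fun s hs => ?_
  subst hs
  rfl

/-! ### Instance lengths are polynomial -/

/-- **The obfuscated instances have polynomial length** (efficiency of `O` on codes, the schedule bound
`κ ≤ p` and the clear code / name length bound at level `n`; obfuscator coins of length `≤ n`). [folklore] -/
theorem exists_poly_length_instL {O : CircuitObfuscator} (hO : O.IsEfficient) (κ h : ℕ → ℕ)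
    (m : ℕ → List Bool → ℕ) (C : (n : ℕ) → (k : List Bool) → Circuit (Fin (m n k)))
    (nm : ℕ → List Bool → List Bool) (hκhi : ∃ p : Polynomial ℕ, ∀ n, κ n ≤ p.eval n)
    (hq : ∃ q : Polynomial ℕ, ∀ (n : ℕ) (k : List Bool), k.length = h n →
      (encodeSizedCircuit ⟨m n k, C n k⟩).length + (nm n k).length ≤ q.eval n) :
    ∃ P : Polynomial ℕ, ∀ (n : ℕ) (k r : List Bool), k.length = h n → r.length ≤ n →
      (xInst O κ (m n) (C n) (nm n) n k r).length ≤ P.eval n := by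
  obtain ⟨Ob, hOb, hObrun⟩ := FPExtension.exists_FP_obf hO
  obtain ⟨sOb, hsOb⟩ := FPExtension.exists_poly_length_le hOb
  obtain ⟨p, hp⟩ := hκhi
  obtain ⟨q, hq⟩ := hq
  refine ⟨2 * X + 4 + 2 * sOb.comp (4 * p + 6 + 2 * q + X) + q, fun n k r hk hr => ?_⟩
  have hclear := hq n k hk
  -- the obfuscated code is `Ob` of an input of polynomial length
  have hcode : (encodeSizedCircuit ⟨m n k, O.obf (κ n) (C n k) r⟩).length ≤
      sOb.eval (4 * p.eval n + 6 + 2 * q.eval n + n) := by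
    rw [← hObrun]
    refine (hsOb _).trans (SeedLaw.natPoly_eval_mono _ ?_)
    simp only [length_boolPair, length_unaryEncodeNat]
    have := hp n
    omega
  simp only [xInst, length_boolPair, length_unaryEncodeNat, eval_add, eval_mul, eval_ofNat, eval_X, eval_comp]
  omega

/-! ### The keyed iO step, `(n, k)`-indexed families -/

/-- **Keyed iO step (eventual, uniform in the key), level-aware families.**  Under a sub-exponentially
secure iO `O` on `ppolyCircuits`, for `(n, k)`-indexed admissible pairs at security parameter `κ n ≥ n^c`
with advice `⟨1ⁿ, ⟨nm n k, ans n k⟩⟩` of polynomial length, the advised iO advantage of `dist A₁ B` between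
`O(κ n, C₀ n k)` and `O(κ n, C₁ n k)` is `≤ 2^{-(κ n)^ε}` for all large `n` and all keys `k ∈ {0,1}^{h n}` at
once. [cite: BitanskyPanethRosen2015, Def. 4.1] -/
theorem eventually_ioAdvantageAdv_leL {ε : ℝ} {O : CircuitObfuscator} (hε : 0 < ε)
    (hO : IsSubexpIO ε ppolyCircuits O) (κ h : ℕ → ℕ) (m : ℕ → List Bool → ℕ)
    (C₀ C₁ : (n : ℕ) → (k : List Bool) → Circuit (Fin (m n k))) (nm ans : ℕ → List Bool → List Bool)
    (hκlo : ∃ c : ℝ, 0 < c ∧ ∀ᶠ n : ℕ in atTop, (n : ℝ) ^ c ≤ κ n)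
    (hadvlen : ∃ q : Polynomial ℕ, ∀ (n : ℕ) (k : List Bool), k.length = h n →
      (nm n k).length + (ans n k).length ≤ q.eval n)
    (hpair : ∀ (n : ℕ) (k : List Bool), k.length = h n →
      (⟨m n k, C₀ n k⟩ : SizedCircuit) ∈ ppolyCircuits (κ n) ∧
        (⟨m n k, C₁ n k⟩ : SizedCircuit) ∈ ppolyCircuits (κ n) ∧
        (C₀ n k).size = (C₁ n k).size ∧ (∀ x, (C₀ n k).eval x = (C₁ n k).eval x))
    {A₁ : RandAlg (List Bool) (List Bool)} (hA₁ : IsPPT A₁ id) (B : Polynomial ℕ) :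
    ∀ᶠ n : ℕ in atTop, ∀ k : List Bool, k.length = h n →
      O.ioAdvantageAdv (dist A₁ B) (fun _ => boolPair (unaryEncodeNat n) (boolPair (nm n k) (ans n k))) (κ n)
        (C₀ n k) (C₁ n k) ≤ (2 : ℝ) ^ (-((κ n : ℝ) ^ ε)) := by
  obtain ⟨c, hc, hev⟩ := hκlo
  obtain ⟨N₀, hN₀⟩ := eventually_atTop.1 hev
  obtain ⟨q, hq⟩ := hadvlen
  set D : ℕ := ⌈1 / c⌉₊ with hD
  have hDc : 1 / c ≤ D := Nat.le_ceil _
  -- advice and its length bound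
  let adv : ℕ → ℕ × List Bool → List Bool := fun _ nk =>
    boolPair (unaryEncodeNat nk.1) (boolPair (nm nk.1 nk.2) (ans nk.1 nk.2))
  let Padv : Polynomial ℕ := (2 * X + 4 + 2 * q).comp (X ^ D + 2)
  have hadv : ∀ᶠ κ₀ : ℕ in atTop, ∀ nk ∈ keys κ h N₀ D κ₀,
      ((adv κ₀ nk).length : ℝ) ≤ (2 : ℝ) ^ ((κ₀ : ℝ) ^ ε) := by
    filter_upwards [eventually_natPoly_le_two_rpow Padv hε] with κ₀ hκ₀
    rintro ⟨n, k⟩ hnk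
    obtain ⟨hn, -, -, hk⟩ := mem_keys.1 hnk
    refine le_trans ?_ hκ₀
    have h1 : (adv κ₀ (n, k)).length ≤ (2 * X + 4 + 2 * q : Polynomial ℕ).eval n := by
      have := hq n k hk
      simp only [adv, length_boolPair, length_unaryEncodeNat, eval_add, eval_mul, eval_ofNat, eval_X]
      omega
    have h2 : (2 * X + 4 + 2 * q : Polynomial ℕ).eval n ≤ Padv.eval κ₀ := by
      simp only [Padv, eval_comp]
      refine SeedLaw.natPoly_eval_mono _ ?_
      simp only [eval_add, eval_pow, eval_X, eval_ofNat]
      exact hn.le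
    exact_mod_cast h1.trans h2
  -- the keyed family, indexed by `(n, k)`
  have hkey := KeyedIndistinguishability.keyed_family_subexp hO (dist A₁ B) (isPPT_dist hA₁ B)
    (keys κ h N₀ D) adv hadv (fun _ nk => m nk.1 nk.2) (fun _ nk => C₀ nk.1 nk.2) (fun _ nk => C₁ nk.1 nk.2)
    (fun κ₀ nk hnk => by
      obtain ⟨-, -, hκ, hk⟩ := mem_keys.1 (show (nk.1, nk.2) ∈ _ from hnk)
      rw [← hκ]; exact (hpair nk.1 nk.2 hk).1)
    (fun κ₀ nk hnk => by
      obtain ⟨-, -, hκ, hk⟩ := mem_keys.1 (show (nk.1, nk.2) ∈ _ from hnk)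
      rw [← hκ]; exact (hpair nk.1 nk.2 hk).2.1)
    (fun κ₀ nk hnk => by
      obtain ⟨-, -, -, hk⟩ := mem_keys.1 (show (nk.1, nk.2) ∈ _ from hnk)
      exact (hpair nk.1 nk.2 hk).2.2.1)
    (fun κ₀ nk hnk => by
      obtain ⟨-, -, -, hk⟩ := mem_keys.1 (show (nk.1, nk.2) ∈ _ from hnk)
      exact (hpair nk.1 nk.2 hk).2.2.2)
  obtain ⟨K₁, hK₁⟩ := eventually_atTop.1 hkey
  -- transfer "eventually in κ₀" to "eventually in n" along κ n ≥ n^c → ∞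
  have hκ_large : ∀ᶠ n : ℕ in atTop, K₁ ≤ κ n := by
    have ht : Tendsto (fun n : ℕ => (n : ℝ) ^ c) atTop atTop :=
      (tendsto_rpow_atTop hc).comp tendsto_natCast_atTop_atTop
    filter_upwards [ht.eventually_ge_atTop (K₁ : ℝ), hev] with n h1 h2
    exact_mod_cast h1.trans h2
  filter_upwards [hκ_large, eventually_ge_atTop N₀] with n hn1 hn2 k hk
  have hmem : (n, k) ∈ keys κ h N₀ D (κ n) :=
    mem_keys.2 ⟨lt_pow_add_two_of_rpow_le hc hDc (hN₀ n hn2), hn2, rfl, hk⟩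
  exact hK₁ (κ n) hn1 (n, k) hmem

/-! ### The stub -/

/-- **STUB `level_bestPossibleStep` (the best-possible step, level-aware families).**  For level-aware
key-indexed families `C₀ n k ≡ C₁ n k` of the same arity, size and function, both in `ppolyCircuits (κ n)`,
a schedule `n^c ≤ κ n ≤ poly(n)` (eventually / always), `h n ≤ n`, polynomially bounded codes / names /
answers, the EVENTUAL coin discipline, and a sub-exponentially secure iO `O` for `P/poly`: clause (C) for the
obfuscations of `C₁` implies clause (C) for the obfuscations of `C₀`. [cite: BitanskyPanethRosen2015, Def. 4.1] -/
theorem level_bestPossibleStep' :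
    ∀ (ε : ℝ) (O : CircuitObfuscator), 0 < ε → IsSubexpIO ε ppolyCircuits O →
    ∀ (κ h : ℕ → ℕ) (m : ℕ → List Bool → ℕ) (C₀ C₁ : (n : ℕ) → (k : List Bool) → Circuit (Fin (m n k)))
      (nm ans : ℕ → List Bool → List Bool),
      (∃ c : ℝ, 0 < c ∧ ∀ᶠ n : ℕ in atTop, (n : ℝ) ^ c ≤ κ n) →
      (∃ p : Polynomial ℕ, ∀ n, κ n ≤ p.eval n) → (∀ n, h n ≤ n) →
      (∃ q : Polynomial ℕ, ∀ (n : ℕ) (k : List Bool), k.length = h n →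
          (encodeSizedCircuit ⟨m n k, C₀ n k⟩).length + (encodeSizedCircuit ⟨m n k, C₁ n k⟩).length +
            (nm n k).length + (ans n k).length ≤ q.eval n) →
      (∀ (n : ℕ) (k : List Bool), k.length = h n →
          (⟨m n k, C₀ n k⟩ : SizedCircuit) ∈ ppolyCircuits (κ n) ∧
          (⟨m n k, C₁ n k⟩ : SizedCircuit) ∈ ppolyCircuits (κ n) ∧
          (C₀ n k).size = (C₁ n k).size ∧ (∀ x, (C₀ n k).eval x = (C₁ n k).eval x)) →
      (∃ n₀ : ℕ, ∀ n, n₀ ≤ n → ∀ k : List Bool, k.length = h n →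
          O.coins (κ n) (C₀ n k) ≤ n - h n ∧ O.coins (κ n) (C₁ n k) ≤ n - h n) →
      ClauseC (genObfL O κ h m C₁ nm) (keyedL h ans) →
      ClauseC (genObfL O κ h m C₀ nm) (keyedL h ans) := by
  intro ε O hε hO κ h m C₀ C₁ nm ans hκlo hκhi hh hq hpair hcoins hC1 A hA
  obtain ⟨q, hq⟩ := hq
  obtain ⟨n₀, hcoins⟩ := hcoins
  have hcoins₀ : ∀ n, n₀ ≤ n → ∀ k : List Bool, k.length = h n → O.coins (κ n) (C₀ n k) ≤ n - h n :=
    fun n hn k hk => (hcoins n hn k hk).1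
  have hcoins₁ : ∀ n, n₀ ≤ n → ∀ k : List Bool, k.length = h n → O.coins (κ n) (C₁ n k) ≤ n - h n :=
    fun n hn k hk => (hcoins n hn k hk).2
  -- (1) normalise `A`
  obtain ⟨pA, hpA⟩ := hA.2
  set A₁ : RandAlg (List Bool) (List Bool) := CoinNormalisation.norm A pA with hA₁def
  have hA₁ : IsPPT A₁ id := CoinNormalisation.isPPT_norm hA pA
  have hstab : ∀ (x : List Bool) (E : Set (List Bool)) (N : ℕ), A₁.coinLen x.length ≤ N →
      uniformProb N {ρ | A₁.run x ρ ∈ E} = A₁.pr id x E :=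
    fun x E N hN => CoinNormalisation.uniformProb_norm_of_le A pA x E hN
  have hB : ∀ L, A₁.coinLen L ≤ (2 * pA + 1 : Polynomial ℕ).eval L := CoinNormalisation.norm_coinLen_le A pA
  -- (2) the per-key gap bound, eventually in `n`, uniformly in `k`
  have hgap := eventually_ioAdvantageAdv_leL hε hO κ h m C₀ C₁ nm ans hκlo
    ⟨q, fun n k hk => by have := hq n k hk; omega⟩ hpair hA₁ (2 * pA + 1)
  -- (3) hence the gap of the success sequences of `A₁`
  have hdiff : ∀ᶠ n : ℕ in atTop,
      |(uniformAvg n fun s =>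
          A₁.pr id (boolPair (unaryEncodeNat n) (genObfL O κ h m C₀ nm s)) {y | keyedL h ans s <+: y}) -
        (uniformAvg n fun s =>
          A₁.pr id (boolPair (unaryEncodeNat n) (genObfL O κ h m C₁ nm s)) {y | keyedL h ans s <+: y})| ≤
        (2 : ℝ) ^ (-((κ n : ℝ) ^ ε)) := by
    filter_upwards [hgap, eventually_ge_atTop n₀] with n hn hn₀
    rw [avgL_eq_key_coins O κ h m C₀ nm ans A₁ hh n (hcoins₀ n hn₀),
      avgL_eq_key_coins O κ h m C₁ nm ans A₁ hh n (hcoins₁ n hn₀)]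
    refine SeedLaw.abs_uniformAvg_sub_le fun k hk => ?_
    rw [gap_eq_ioAdvantageAdv O hstab hB κ (m n) (C₀ n) (C₁ n) (nm n) (ans n) n k]
    exact hn k hk
  -- (4) `2^{-(κ n)^ε} ≤ 2^{-n^{cε}}` eventually, and the latter is negligible
  obtain ⟨c, hc, hev⟩ := hκlo
  have hδ : SuperpolynomialDecay atTop (fun n : ℕ => (n : ℝ)) fun n : ℕ => (2 : ℝ) ^ (-((n : ℝ) ^ (c * ε))) :=
    superpolynomialDecay_two_rpow_neg (mul_pos hc hε)
  have hδle : ∀ᶠ n : ℕ in atTop, (2 : ℝ) ^ (-((κ n : ℝ) ^ ε)) ≤ (2 : ℝ) ^ (-((n : ℝ) ^ (c * ε))) := by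
    filter_upwards [hev] with n hn
    have h1 : ((n : ℝ) ^ c) ^ ε ≤ (κ n : ℝ) ^ ε := Real.rpow_le_rpow (by positivity) hn hε.le
    rw [← Real.rpow_mul (Nat.cast_nonneg n)] at h1
    exact Real.rpow_le_rpow_of_exponent_le one_le_two (neg_le_neg h1)
  -- (5) the success sequence of `A₁` against `C₀` decays
  have h1 : SuperpolynomialDecay atTop (fun n : ℕ => (n : ℝ)) fun n : ℕ => uniformAvg n fun s =>
      A₁.pr id (boolPair (unaryEncodeNat n) (genObfL O κ h m C₀ nm s)) {y | keyedL h ans s <+: y} := by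
    refine ((hC1 A₁ hA₁).add hδ).trans_eventually_abs_le ?_
    filter_upwards [hdiff, hδle] with n hn hn'
    simp only [Function.comp_apply, Pi.add_apply]
    rw [abs_of_nonneg (avgL_nonneg _ _ _ _ _ _ _ _ _),
      abs_of_nonneg (add_nonneg (avgL_nonneg _ _ _ _ _ _ _ _ _) (by positivity))]
    have := (abs_sub_le_iff.1 hn).1
    linarith
  -- (6) the success of `A` against `C₀` is at most `poly ·` the success of `A₁`
  obtain ⟨P, hP⟩ := exists_poly_length_instL hO.isEfficient κ h m C₀ nm hκhi
    ⟨q, fun n k hk => by have := hq n k hk; omega⟩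
  let L : Polynomial ℕ := 2 * pA.comp P + 2
  have hdom : ∀ n, n₀ ≤ n →
      (uniformAvg n fun s =>
          A.pr id (boolPair (unaryEncodeNat n) (genObfL O κ h m C₀ nm s)) {y | keyedL h ans s <+: y}) ≤
        ((L.eval n : ℕ) : ℝ) * uniformAvg n fun s =>
          A₁.pr id (boolPair (unaryEncodeNat n) (genObfL O κ h m C₀ nm s)) {y | keyedL h ans s <+: y} := by
    intro n hn₀
    rw [avgL_eq_key_coins O κ h m C₀ nm ans A hh n (hcoins₀ n hn₀),
      avgL_eq_key_coins O κ h m C₀ nm ans A₁ hh n (hcoins₀ n hn₀), ← SeedLaw.uniformAvg_const_mul]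
    refine SeedLaw.uniformAvg_mono fun k hk => ?_
    rw [← SeedLaw.uniformAvg_const_mul]
    refine SeedLaw.uniformAvg_mono fun r hr => ?_
    refine (CoinNormalisation.pr_le_two_pow_mul A pA _ _ (hpA _)).trans ?_
    refine mul_le_mul_of_nonneg_right ?_ (RandAlg.pr_nonneg _ _ _ _)
    refine (CoinNormalisation.two_pow_width_le pA _).trans ?_
    have hlen : (xInst O κ (m n) (C₀ n) (nm n) n k r).length ≤ P.eval n :=
      hP n k r hk (hr.le.trans ((hcoins₀ n hn₀ k hk).trans (Nat.sub_le _ _)))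
    have : pA.eval (xInst O κ (m n) (C₀ n) (nm n) n k r).length ≤ pA.eval (P.eval n) :=
      SeedLaw.natPoly_eval_mono _ hlen
    have : (2 * pA.eval (xInst O κ (m n) (C₀ n) (nm n) n k r).length + 2 : ℝ) ≤ ((L.eval n : ℕ) : ℝ) := by
      simp only [L, eval_add, eval_mul, eval_ofNat, eval_comp]
      exact_mod_cast (by omega :
        2 * pA.eval (xInst O κ (m n) (C₀ n) (nm n) n k r).length + 2 ≤ 2 * pA.eval (P.eval n) + 2)
    exact this
  -- (7) conclude
  have h2 : SuperpolynomialDecay atTop (fun n : ℕ => (n : ℝ))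
      (fun n : ℕ => ((L.map (Nat.castRingHom ℝ)).eval (n : ℝ)) * uniformAvg n fun s =>
        A₁.pr id (boolPair (unaryEncodeNat n) (genObfL O κ h m C₀ nm s)) {y | keyedL h ans s <+: y}) :=
    h1.polynomial_mul _
  refine h2.trans_eventually_abs_le ?_
  filter_upwards [eventually_ge_atTop n₀] with n hn₀
  simp only [Function.comp_apply, Polynomial.eval_natCast_map, Nat.coe_castRingHom, Nat.cast_id]
  rw [abs_of_nonneg (avgL_nonneg _ _ _ _ _ _ _ _ _),
    abs_of_nonneg (mul_nonneg (Nat.cast_nonneg _) (avgL_nonneg _ _ _ _ _ _ _ _ _))]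
  exact hdom n hn₀

end LevelBps

/-- **STUB `level_bestPossibleStep`** of line `knowledge-of-walk-split` (instantiation pass; registered name
and signature): the best-possible step for LEVEL-AWARE key-indexed families — under a sub-exponentially
secure iO for `P/poly`, clause (C) for the obfuscations of `C₁ n k` implies clause (C) for the obfuscations of
the functionally equivalent, equal-size `C₀ n k`. [cite: BitanskyPanethRosen2015, Def. 4.1] -/
theorem level_bestPossibleStep : ∀ (ε : ℝ) (O : CircuitObfuscator), 0 < ε → IsSubexpIO ε ppolyCircuits O →
    ∀ (κ h : ℕ → ℕ) (m : ℕ → List Bool → ℕ) (C₀ C₁ : (n : ℕ) → (k : List Bool) → Circuit (Fin (m n k)))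
    (nm ans : ℕ → List Bool → List Bool), (∃ c : ℝ, 0 < c ∧ ∀ᶠ n : ℕ in atTop, (n : ℝ) ^ c ≤ κ n) →
    (∃ p : Polynomial ℕ, ∀ n, κ n ≤ p.eval n) → (∀ n, h n ≤ n) →
    (∃ q : Polynomial ℕ, ∀ (n : ℕ) (k : List Bool), k.length = h n →
      (encodeSizedCircuit ⟨m n k, C₀ n k⟩).length + (encodeSizedCircuit ⟨m n k, C₁ n k⟩).length +
        (nm n k).length + (ans n k).length ≤ q.eval n) →
    (∀ (n : ℕ) (k : List Bool), k.length = h n →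
      (⟨m n k, C₀ n k⟩ : SizedCircuit) ∈ ppolyCircuits (κ n) ∧
      (⟨m n k, C₁ n k⟩ : SizedCircuit) ∈ ppolyCircuits (κ n) ∧
      (C₀ n k).size = (C₁ n k).size ∧ (∀ x, (C₀ n k).eval x = (C₁ n k).eval x)) →
    (∃ n₀ : ℕ, ∀ n, n₀ ≤ n → ∀ k : List Bool, k.length = h n →
      O.coins (κ n) (C₀ n k) ≤ n - h n ∧ O.coins (κ n) (C₁ n k) ≤ n - h n) →
    ClauseC (genObfL O κ h m C₁ nm) (keyedL h ans) → ClauseC (genObfL O κ h m C₀ nm) (keyedL h ans) :=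
  LevelBps.level_bestPossibleStep'

end Summit.QuantumAdvantage.QuantumAdvantage.Theorems.WbwObfuscatedGluedTrees.KnowledgeOfWalk

end
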